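import Literature.Geometry.Lorentzian.SchwarzschildKerrSchildComponents
import Literature.Geometry.Lorentzian.IsometryProofs
import Literature.Geometry.Manifold.OpenSubmanifoldMFDeriv
import HarnessLib

/-!
# The Schwarzschild exterior in static and in isotropic coordinates, and its isometries onto the
# Kerr–Schild chart

The prelude realises the Schwarzschild exterior `{r > 2M}` as the `a = 0` member of the Kerr
family in *ingoing Kerr–Schild Cartesian coordinates* `(t*, x⃗)` on `Kerr.exterior M 0 ⊆ E4`,
`g_KS = η + (2M/r) ℓ ⊗ ℓ`, `ℓ = dt* + dr`, `r = ‖x⃗‖` (`KerrSchild.lean`, `Kerr.bilin M 0`,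
`Kerr.smoothMetric M 0 r₊`; `SchwarzschildKerrSchildComponents.lean`), and the uniqueness
statements of the tree conclude with an isometry onto THIS chart
(`StationaryAFBlackHole.IsIsometricToSchwarzschildExterior`,
`Literature.Geometry.Lorentzian.ChruscielGalloway2010_docStaticUniqueness`, …). The classification
theorems of static vacuum black holes (Israel, Bunting–Masood-ul-Alam, Chruściel; Chruściel–Costa
2008, Thm. 1.4), on the other hand, produce the Schwarzschild metric in its manifestly **static**
form `−V² dt² + γ`, `V² = 1 − 2M/r`, `γ = dr²/(1 − 2M/r) + r² dΩ²` (Griffiths–Podolský 2009,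
(8.1)). This file supplies the last, explicit step between the two: the Eddington–Finkelstein
change of time.

On the same chart domain `Kerr.exterior M 0 = {(t, x⃗) | ‖x⃗‖ > max(r₊, 0)}` (`r₊ = 2M` for
`M ≥ 0`) we define

* `Schwarzschild.staticBilin M x` — the static Schwarzschild metric in Cartesian coordinates
  `(t, x⃗)`, `x⃗ = r n̂`:
  `g_static = −(1 − 2M/r) dt² + dx⃗² + (2M/(r − 2M)) dr²`, `dr = ⟪x⃗, dx⃗⟫/r`
  (Griffiths–Podolský 2009, (8.1), with `dr² + r² dΩ² = dx⃗²`); `staticBilin_apply`;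
* `Schwarzschild.timeShift M x = 2M log(r − 2M)` and the map
  `Schwarzschild.toKSFun M (t, x⃗) = (t + 2M log(r − 2M), x⃗)` with inverse `ofKSFun`
  (Griffiths–Podolský 2009, §8.2: the tortoise coordinate `r* = r + 2m log|r/2m − 1|` (8.4), the
  advanced time `v = t + r*` and the Eddington–Finkelstein time `t̄ = v − r = t + 2m log|r/2m − 1|`,
  p. 111; the prelude's `t*` is `t̄`, and our `timeShift` differs from `2m log|r/2m − 1|` by the
  constant `2M log 2M`, a `t*`-translation, so that it is smooth on the chart for every real `M`);
* `Schwarzschild.jacobian M x = id + ∂₀ ⊗ dτ`, `dτ = (2M/((r − 2M) r)) ⟪x⃗, ·⟫`, the derivative of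
  `toKSFun M` (`hasFDerivAt_toKSFun`), and the **pull-back identity**
  `g_KS(toKSFun x)(J v, J w) = g_static(x)(v, w)` (`kerrBilin_jacobian`: Griffiths–Podolský 2009,
  (8.5)–(8.6) read backwards, `−(1 − 2m/r) dv² + 2 dv dr + r² dΩ² = η + (2m/r)(dt̄ + dr)²`);
* `Schwarzschild.toKerrSchild M : Diffeomorph 𝓘(ℝ, E4) 𝓘(ℝ, E4) (Kerr.exterior M 0) (Kerr.exterior M 0) ∞`,
  its differential `mfderiv_toKerrSchild = jacobian`, and
  `pullbackBilin_toKerrSchild : (toKerrSchild M)^* g_KS = g_static`;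
* under the prelude's `[Kerr.Facts]`: `Schwarzschild.staticMetric M`, the static form as a `C^∞`
  Lorentzian metric on `Kerr.exterior M 0` (the pull-back `LorentzianMetric.comap` of
  `Kerr.smoothMetric M 0 r₊`), `staticMetric_val : (staticMetric M).val x = staticBilin M x`, and
  `Schwarzschild.isIsometry_toKerrSchild : IsIsometry (staticMetric M) (Kerr.smoothMetric M 0 r₊) (toKerrSchild M)`;
* the dictionary: `jacobian_basisVector_zero` (`∂_t ↦ ∂_{t*}`: the static Killing field is the
  prelude's `Kerr.stationaryField`), `staticBilin_basisVector_zero_left`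
  (`g_static(∂_t, ·) = −(1 − 2M/r) dt`: `∂_t` is orthogonal to the slices `{t = const}`, i.e.
  manifestly hypersurface-orthogonal, and `g_static(∂_t, ∂_t) = −(1 − 2M/r) < 0` on `{r > 2M}`).

Everything is proved; the definitions carrying data (`staticBilin`, `toKerrSchild`,
`staticMetric`, and their isotropic counterparts below) have explicit bodies. Use: a proof of a
static uniqueness theorem that has identified `(⟨⟨M_ext⟩⟩, g)` with `(ℝ × {r > 2M}, g_static)` through
a diffeomorphism `Ψ` obtains the diffeomorphism onto the Kerr–Schild exterior demanded by
`IsIsometricToSchwarzschildExterior` as `toKerrSchild M ∘ Ψ` (`isIsometry_trans_toKerrSchild`, by the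
composition of isometries `PseudoRiemannianMetric.IsIsometry.trans` = `pullbackBilin_comp`).

**Isotropic coordinates.** The proofs through the positive energy theorem (Bunting–Masood-ul-Alam;
Chruściel–Costa 2008, Thm. 1.4) deliver a conformally flat `3`-metric, i.e. the Schwarzschild metric
in *isotropic* coordinates `(t, y⃗)`, `ρ = ‖y⃗‖ > M/2`:
`g_iso = −((1 − M/2ρ)/(1 + M/2ρ))² dt² + (1 + M/2ρ)⁴ dy⃗²` (Baumgarte–Shapiro 2021, Exercise 1.5,
(1.44)–(1.45); Exercise 2.19, (2.109)). The second half of the file treats this chart in the same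
way: `Schwarzschild.isotropicBilin`, the change of radius `Schwarzschild.toStaticFun M (t, y⃗) =
(t, (1 + M/2ρ)² y⃗)` (areal radius `r = ρ(1 + M/2ρ)²`, (1.44)) with inverse `ofStaticFun`
(`ρ = (r − M + √(r(r − 2M)))/2`, `Schwarzschild.isoRadius`), its Jacobian `isoJacobian` and the
pull-back identity `staticBilin_isoJacobian : (toStaticFun)^* g_static = g_iso`, and, for `M ≥ 0`,
the diffeomorphism `Schwarzschild.ofIsotropic hM : {ρ > max(M/2, 0)} ≅ Kerr.exterior M 0`
(`Schwarzschild.isotropicRegion`), `mfderiv_ofIsotropic`, `pullbackBilin_ofIsotropic`, the metric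
`Schwarzschild.isotropicMetric hM := comap` with `isotropicMetric_val`, and the isometries
`isIsometry_ofIsotropic` (onto the static chart), `isIsometry_ofIsotropic_trans_toKerrSchild` (onto
the Kerr–Schild chart) and `isIsometry_trans_ofIsotropic_trans_toKerrSchild` (composition shape).

## References

* J. B. Griffiths, J. Podolský, *Exact Space-Times in Einstein's General Relativity*, Cambridge
  University Press 2009, §8.1 eq. (8.1), §8.2 eqs. (8.4)–(8.6) and p. 111. [`GriffithsPodolsky2009`]
* T. W. Baumgarte, S. L. Shapiro, *Numerical Relativity: Starting from Scratch*, Cambridge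
  University Press 2021, §1.3.1, Exercise 1.5 (1.44)–(1.45), Exercise 1.7, Exercise 2.19 (2.109).
  [`BaumgarteShapiro2021`]
* A. S. Eddington, Nature 113 (1924) 192; D. Finkelstein, Phys. Rev. 110 (1958) 965–967.
* B. O'Neill, *Semi-Riemannian geometry* (1983), Ch. 3, Def. 3.4 and pp. 90–91 (isometries,
  pulled-back metrics). [`ONeill1983`]
* P. T. Chruściel, J. L. Costa, *On uniqueness of stationary vacuum black holes*, Astérisque 321
  (2008), Thm. 1.4. [`ChruscielCosta2008`]
-/

noncomputable section

-- instance search through the nested operator type `E4 →L[ℝ] E4 →L[ℝ] ℝ` (as in the tree files)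
set_option maxSynthPendingDepth 3

open Bundle Set Function TopologicalSpace Manifold
open scoped Manifold ContDiff Topology InnerProductSpace

namespace Literature.Geometry.Lorentzian

/-! ### Composition of isometries -/

section IsometryTrans

variable {EM EN EP HM HN HP : Type*} [NormedAddCommGroup EM] [NormedSpace ℝ EM]
  [NormedAddCommGroup EN] [NormedSpace ℝ EN] [NormedAddCommGroup EP] [NormedSpace ℝ EP]
  [TopologicalSpace HM] [TopologicalSpace HN] [TopologicalSpace HP]
  {IM : ModelWithCorners ℝ EM HM} {IN : ModelWithCorners ℝ EN HN} {IP : ModelWithCorners ℝ EP HP}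
  {XM XN XP : Type*} [TopologicalSpace XM] [ChartedSpace HM XM] [TopologicalSpace XN]
  [ChartedSpace HN XN] [TopologicalSpace XP] [ChartedSpace HP XP]
  [IsManifold IM ∞ XM] [IsManifold IN ∞ XN] [IsManifold IP ∞ XP] {n m : ℕ∞ω}
  {gN : PseudoRiemannianMetric IN n EN (TangentSpace IN : XN → Type _)}
  {gM : PseudoRiemannianMetric IM n EM (TangentSpace IM : XM → Type _)}
  {gP : PseudoRiemannianMetric IP n EP (TangentSpace IP : XP → Type _)}

/-- **Isometries compose**: if `Φ : N ≅ M` and `Ψ : M ≅ P` are isometries (of class `C^m`,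
`m ≠ 0`), so is `Ψ ∘ Φ : N ≅ P` — the chain rule `(Ψ ∘ Φ)^* g_P = Φ^* (Ψ^* g_P)`
(`pullbackBilin_comp`). O'Neill 1983, Ch. 3, p. 58 and Def. 3.4. [cite: ONeill1983, Ch. 3, Def. 3.4 (p. 58)] -/
theorem PseudoRiemannianMetric.IsIsometry.trans {Φ : Diffeomorph IN IM XN XM m}
    {Ψ : Diffeomorph IM IP XM XP m} (hm : m ≠ 0) (hΦ : IsIsometry gN gM Φ)
    (hΨ : IsIsometry gM gP Ψ) : IsIsometry gN gP (Φ.trans Ψ) := by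
  intro y
  rw [Diffeomorph.coe_trans, pullbackBilin_comp (Ψ.contMDiff.mdifferentiable hm)
    (Φ.contMDiff.mdifferentiable hm), funext hΨ]
  exact hΦ y

end IsometryTrans

namespace Schwarzschild

/-! ### The static form of the Schwarzschild metric in Cartesian coordinates -/

/-- **The Schwarzschild metric in static Cartesian coordinates** `(t, x⃗)`, `r = ‖x⃗‖`:
`g_static = η + (2M/r) dt ⊗ dt + (2M/((r − 2M) r²)) ⟪x⃗, ·⟫ ⊗ ⟪x⃗, ·⟫`, i.e.
`−(1 − 2M/r) dt² + dx⃗² + (2M/(r − 2M)) dr²` with `dr = ⟪x⃗, dx⃗⟫/r` — the line element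
`−(1 − 2m/r) dt² + (1 − 2m/r)⁻¹ dr² + r²(dθ² + sin²θ dφ²)` of Griffiths–Podolský 2009, (8.1),
written with `dr² + r² dΩ² = dx⃗²`. A continuous bilinear form on `E4` for every `x` (junk where
`r = 0` or `r = 2M`, outside the chart `Kerr.exterior M 0`). [cite: GriffithsPodolsky2009, §8.1 (8.1)] -/
def staticBilin (M : ℝ) (x : E4) : E4 →L[ℝ] E4 →L[ℝ] ℝ :=
  Minkowski.bilin + (2 * M / E4.spatialNorm x) • E4.tmul (E4.dx 0) (E4.dx 0) +
    (2 * M / ((E4.spatialNorm x - 2 * M) * E4.spatialNorm x ^ 2)) • E4.tmul (sdotCLM x) (sdotCLM x)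

/-- `g_static(v, w) = −(1 − 2M/r) v⁰w⁰ + ⟪v⃗, w⃗⟫ + (2M/(r − 2M)) ν(v) ν(w)`, `ν(v) = ⟪x⃗, v⃗⟫/r`
(the radial components; `Schwarzschild.nu`). Griffiths–Podolský 2009, (8.1). [cite: GriffithsPodolsky2009, §8.1 (8.1)] -/
theorem staticBilin_apply (M : ℝ) (x v w : E4) :
    staticBilin M x v w =
      -((1 - 2 * M / E4.spatialNorm x) * (v 0 * w 0)) + sdot v w +
        2 * M / (E4.spatialNorm x - 2 * M) * (nu x v * nu x w) := by
  have hdx : ∀ u : E4, E4.dx 0 u = u 0 := fun u ↦ rfl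
  simp only [staticBilin, add_apply, smul_apply,
    E4.tmul_apply, sdotCLM_apply, hdx, smul_eq_mul, Kerr.minkowski_bilin_eq_spatial, nu]
  rw [← sdot]
  by_cases hr : E4.spatialNorm x = 0
  · simp [hr]
  · field_simp
    ring

/-- The static metric is symmetric. [cite: GriffithsPodolsky2009, §8.1 (8.1)] -/
theorem staticBilin_symm (M : ℝ) (x v w : E4) : staticBilin M x v w = staticBilin M x w v := by
  rw [staticBilin_apply, staticBilin_apply, sdot_comm v w]
  ring

/-- **`∂_t` is orthogonal to the slices `{t = const}`**: `g_static(∂_t, w) = −(1 − 2M/r) w⁰`, i.e.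
`(∂_t)♭ = −(1 − 2M/r) dt` — the static Killing field is manifestly hypersurface-orthogonal.
Griffiths–Podolský 2009, (8.1). [cite: GriffithsPodolsky2009, §8.1 (8.1)] -/
theorem staticBilin_basisVector_zero_left (M : ℝ) (x w : E4) :
    staticBilin M x (E4.basisVector 0) w = -((1 - 2 * M / E4.spatialNorm x) * w 0) := by
  have h0 : E4.spatial (E4.basisVector 0) = 0 := by
    ext i
    simp [E4.spatial_apply, Fin.succ_ne_zero]
  rw [staticBilin_apply]
  simp [sdot, nu, h0]

/-- `g_static(∂_t, ∂_t) = −(1 − 2M/r)`: the static Killing field is timelike exactly where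
`r > 2M`. Griffiths–Podolský 2009, (8.1). [cite: GriffithsPodolsky2009, §8.1 (8.1)] -/
theorem staticBilin_basisVector_zero_zero (M : ℝ) (x : E4) :
    staticBilin M x (E4.basisVector 0) (E4.basisVector 0) = -(1 - 2 * M / E4.spatialNorm x) := by
  rw [staticBilin_basisVector_zero_left]
  simp

/-- On `{r > 2M}` (and `r > 0`) the static Killing field `∂_t` is timelike:
`g_static(∂_t, ∂_t) < 0`. Griffiths–Podolský 2009, §8.1. [cite: GriffithsPodolsky2009, §8.1 (8.1)] -/
theorem staticBilin_basisVector_zero_zero_neg (M : ℝ) {x : E4} (hr : 0 < E4.spatialNorm x)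
    (h2 : 2 * M < E4.spatialNorm x) :
    staticBilin M x (E4.basisVector 0) (E4.basisVector 0) < 0 := by
  rw [staticBilin_basisVector_zero_zero, neg_lt_zero, sub_pos, div_lt_one hr]
  exact h2

/-! ### The Eddington–Finkelstein change of time -/

/-- The **time shift** `τ(x) = 2M log(r − 2M)` between the static time `t` and the
Kerr–Schild / Eddington–Finkelstein time `t* = t̄ = v − r = t + 2m log|r/2m − 1|`
(Griffiths–Podolský 2009, §8.2, (8.4) and p. 111), up to the additive constant `2M log 2M`
(irrelevant: `∂_{t*}` is a Killing field of `g_KS`), chosen so that `τ` is smooth on the chart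
`Kerr.exterior M 0` for every real `M`. [cite: GriffithsPodolsky2009, §8.2 (8.4), p. 111] -/
def timeShift (M : ℝ) (x : E4) : ℝ := 2 * M * Real.log (E4.spatialNorm x - 2 * M)

/-- The time shift depends on `x⃗` only. [cite: GriffithsPodolsky2009, §8.2 (8.4)] -/
theorem timeShift_add_smul_basisVector_zero (M : ℝ) (x : E4) (t : ℝ) :
    timeShift M (x + t • E4.basisVector 0) = timeShift M x := by
  simp only [timeShift, E4.spatialNorm, Kerr.spatial_add_smul_basisVector_zero]

/-- **From static to Kerr–Schild coordinates**: `(t, x⃗) ↦ (t + 2M log(r − 2M), x⃗)`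
(Griffiths–Podolský 2009, §8.2: `t̄ = t + 2m log|r/2m − 1|`, p. 111). [cite: GriffithsPodolsky2009, §8.2 p. 111] -/
def toKSFun (M : ℝ) (x : E4) : E4 := x + timeShift M x • E4.basisVector 0

/-- **From Kerr–Schild to static coordinates**: `(t*, x⃗) ↦ (t* − 2M log(r − 2M), x⃗)`
(Griffiths–Podolský 2009, §8.2, p. 111). [cite: GriffithsPodolsky2009, §8.2 p. 111] -/
def ofKSFun (M : ℝ) (x : E4) : E4 := x - timeShift M x • E4.basisVector 0

/-- `ofKSFun` is a left inverse of `toKSFun`. [cite: GriffithsPodolsky2009, §8.2 p. 111] -/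
theorem ofKSFun_toKSFun (M : ℝ) (x : E4) : ofKSFun M (toKSFun M x) = x := by
  rw [ofKSFun, toKSFun, timeShift_add_smul_basisVector_zero, add_sub_cancel_right]

/-- `ofKSFun` is a right inverse of `toKSFun`. [cite: GriffithsPodolsky2009, §8.2 p. 111] -/
theorem toKSFun_ofKSFun (M : ℝ) (x : E4) : toKSFun M (ofKSFun M x) = x := by
  have h : ofKSFun M x = x + (-timeShift M x) • E4.basisVector 0 := by
    rw [ofKSFun, neg_smul, sub_eq_add_neg]
  rw [toKSFun, h, timeShift_add_smul_basisVector_zero, neg_smul, ← sub_eq_add_neg, sub_add_cancel]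

/-- The spatial part is unchanged: `(toKSFun M x)⃗ = x⃗`. [cite: GriffithsPodolsky2009, §8.2 p. 111] -/
theorem spatial_toKSFun (M : ℝ) (x : E4) : E4.spatial (toKSFun M x) = E4.spatial x := by
  rw [toKSFun, Kerr.spatial_add_smul_basisVector_zero]

/-- The Kerr–Schild radius is unchanged: `r(toKSFun M x) = r(x)`. [cite: GriffithsPodolsky2009, §8.2 p. 111] -/
theorem radius_toKSFun (M a : ℝ) (x : E4) : Kerr.radius a (toKSFun M x) = Kerr.radius a x := by
  rw [toKSFun, Kerr.radius_add_time_smul_basisVector]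

/-- The Kerr–Schild radius is unchanged: `r(ofKSFun M x) = r(x)`. [cite: GriffithsPodolsky2009, §8.2 p. 111] -/
theorem radius_ofKSFun (M a : ℝ) (x : E4) : Kerr.radius a (ofKSFun M x) = Kerr.radius a x := by
  rw [ofKSFun, sub_eq_add_neg, ← neg_smul, Kerr.radius_add_time_smul_basisVector]

/-! ### Derivatives -/

/-- `D r (x) = r⁻¹ ⟪x⃗, ·⟫` off the time axis (`r = ‖x⃗‖`). [folklore] -/
theorem hasFDerivAt_spatialNorm {x : E4} (hx : E4.spatial x ≠ 0) :
    HasFDerivAt E4.spatialNorm ((E4.spatialNorm x)⁻¹ • sdotCLM x) x := by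
  have h := (Kerr.hasFDerivAt_norm_E3 hx).comp x E4.spatial.hasFDerivAt
  rw [ContinuousLinearMap.smul_comp] at h
  exact h

/-- The derivative `dτ = (2M/((r − 2M) r)) ⟪x⃗, ·⟫ = (2M/(r − 2M)) dr` of the time shift, as a
covector on `E4`. Griffiths–Podolský 2009, §8.2 (from (8.4): `d(r* − r) = (2m/(r − 2m)) dr`). [cite: GriffithsPodolsky2009, §8.2 (8.4)] -/
def timeShiftDeriv (M : ℝ) (x : E4) : E4 →L[ℝ] ℝ :=
  (2 * M / ((E4.spatialNorm x - 2 * M) * E4.spatialNorm x)) • sdotCLM x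

/-- `dτ(v) = (2M/(r − 2M)) ν(v)`. [cite: GriffithsPodolsky2009, §8.2 (8.4)] -/
theorem timeShiftDeriv_apply (M : ℝ) (x v : E4) :
    timeShiftDeriv M x v = 2 * M / (E4.spatialNorm x - 2 * M) * nu x v := by
  simp only [timeShiftDeriv, smul_apply, sdotCLM_apply, smul_eq_mul, nu]
  by_cases hr : E4.spatialNorm x = 0
  · simp [hr]
  · field_simp

/-- `dτ(∂_t) = 0`: the shift does not depend on `t`. [cite: GriffithsPodolsky2009, §8.2 (8.4)] -/
theorem timeShiftDeriv_basisVector_zero (M : ℝ) (x : E4) :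
    timeShiftDeriv M x (E4.basisVector 0) = 0 := by
  have h0 : E4.spatial (E4.basisVector 0) = 0 := by
    ext i
    simp [E4.spatial_apply, Fin.succ_ne_zero]
  simp [timeShiftDeriv, sdot, h0]

/-- `Dτ(x) = timeShiftDeriv M x` off `{r = 0} ∪ {r = 2M}`. [cite: GriffithsPodolsky2009, §8.2 (8.4)] -/
theorem hasFDerivAt_timeShift {M : ℝ} {x : E4} (hx : E4.spatial x ≠ 0)
    (h2 : E4.spatialNorm x - 2 * M ≠ 0) :
    HasFDerivAt (timeShift M) (timeShiftDeriv M x) x := by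
  have h1 : HasFDerivAt (fun y ↦ E4.spatialNorm y - 2 * M)
      ((E4.spatialNorm x)⁻¹ • sdotCLM x) x :=
    (hasFDerivAt_spatialNorm hx).sub_const _
  have h3 := ((Real.hasDerivAt_log h2).comp_hasFDerivAt x h1).const_mul (2 * M)
  refine h3.congr_fderiv ?_
  rw [timeShiftDeriv, smul_smul, smul_smul]
  congr 1
  have hr : E4.spatialNorm x ≠ 0 := by
    simpa [E4.spatialNorm] using hx
  field_simp

/-- The time shift is smooth off `{r = 0} ∪ {r = 2M}`. [cite: GriffithsPodolsky2009, §8.2 (8.4)] -/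
theorem contDiffAt_timeShift {M : ℝ} {x : E4} (hx : E4.spatial x ≠ 0)
    (h2 : E4.spatialNorm x - 2 * M ≠ 0) {n : WithTop ℕ∞} :
    ContDiffAt ℝ n (timeShift M) x := by
  have h1 : ContDiffAt ℝ n E4.spatialNorm x :=
    (contDiffAt_norm ℝ hx).comp x E4.spatial.contDiff.contDiffAt
  exact contDiffAt_const.mul ((h1.sub contDiffAt_const).log h2)

/-- **The Jacobian of the change of time**: `J_x v = v + dτ(v) ∂_{t*}`, i.e. `dt* = dt + dτ`,
`dx⃗* = dx⃗` (Griffiths–Podolský 2009, §8.2: `dt̄ = dt + (2m/(r − 2m)) dr`). [cite: GriffithsPodolsky2009, §8.2 (8.4)–(8.6)] -/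
def jacobian (M : ℝ) (x : E4) : E4 →L[ℝ] E4 :=
  ContinuousLinearMap.id ℝ E4 + (timeShiftDeriv M x).smulRight (E4.basisVector 0)

/-- `J_x v = v + dτ(v) ∂_{t*}`. [cite: GriffithsPodolsky2009, §8.2 (8.4)–(8.6)] -/
theorem jacobian_apply (M : ℝ) (x v : E4) :
    jacobian M x v = v + timeShiftDeriv M x v • E4.basisVector 0 := rfl

/-- The time component: `(J v)⁰ = v⁰ + dτ(v)`. [cite: GriffithsPodolsky2009, §8.2 (8.4)–(8.6)] -/
theorem jacobian_apply_zero (M : ℝ) (x v : E4) :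
    jacobian M x v 0 = v 0 + timeShiftDeriv M x v := by
  rw [jacobian_apply]
  simp

/-- The spatial part is unchanged: `(J v)⃗ = v⃗`. [cite: GriffithsPodolsky2009, §8.2 (8.4)–(8.6)] -/
theorem spatial_jacobian (M : ℝ) (x v : E4) : E4.spatial (jacobian M x v) = E4.spatial v := by
  rw [jacobian_apply, Kerr.spatial_add_smul_basisVector_zero]

/-- **`∂_t ↦ ∂_{t*}`**: the Jacobian fixes `∂₀`, so the static Killing field `∂_t` corresponds to
the prelude's stationary Killing field `∂_{t*}` (`Kerr.stationaryField`). [cite: GriffithsPodolsky2009, §8.2 p. 111] -/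
theorem jacobian_basisVector_zero (M : ℝ) (x : E4) :
    jacobian M x (E4.basisVector 0) = E4.basisVector 0 := by
  rw [jacobian_apply, timeShiftDeriv_basisVector_zero, zero_smul, add_zero]

/-- The Jacobian is injective (indeed `J⁻¹ v = v − dτ(v) ∂_{t*}`). [cite: GriffithsPodolsky2009, §8.2 (8.4)–(8.6)] -/
theorem jacobian_injective (M : ℝ) (x : E4) : Function.Injective (jacobian M x) := by
  intro v w h
  have hs : E4.spatial v = E4.spatial w := by
    rw [← spatial_jacobian M x v, h, spatial_jacobian]
  have hd : timeShiftDeriv M x v = timeShiftDeriv M x w := by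
    simp only [timeShiftDeriv, smul_apply, sdotCLM_apply, sdot, hs]
  have h0 : v 0 = w 0 := by
    have := congrArg (fun u : E4 ↦ u 0) h
    simp only [jacobian_apply_zero, hd] at this
    linarith
  rw [← E4.ofTimeSpace_time_spatial v, ← E4.ofTimeSpace_time_spatial w]
  simp only [E4.time, hs, h0]

/-- `D(toKSFun M)(x) = J_x` off `{r = 0} ∪ {r = 2M}`. [cite: GriffithsPodolsky2009, §8.2 (8.4)–(8.6)] -/
theorem hasFDerivAt_toKSFun {M : ℝ} {x : E4} (hx : E4.spatial x ≠ 0)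
    (h2 : E4.spatialNorm x - 2 * M ≠ 0) :
    HasFDerivAt (toKSFun M) (jacobian M x) x :=
  (hasFDerivAt_id x).add ((hasFDerivAt_timeShift hx h2).smul_const (E4.basisVector 0))

/-- `toKSFun M` is smooth off `{r = 0} ∪ {r = 2M}`. [cite: GriffithsPodolsky2009, §8.2 (8.4)–(8.6)] -/
theorem contDiffAt_toKSFun {M : ℝ} {x : E4} (hx : E4.spatial x ≠ 0)
    (h2 : E4.spatialNorm x - 2 * M ≠ 0) {n : WithTop ℕ∞} :
    ContDiffAt ℝ n (toKSFun M) x :=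
  contDiffAt_id.add ((contDiffAt_timeShift hx h2).smul contDiffAt_const)

/-- `ofKSFun M` is smooth off `{r = 0} ∪ {r = 2M}`. [cite: GriffithsPodolsky2009, §8.2 (8.4)–(8.6)] -/
theorem contDiffAt_ofKSFun {M : ℝ} {x : E4} (hx : E4.spatial x ≠ 0)
    (h2 : E4.spatialNorm x - 2 * M ≠ 0) {n : WithTop ℕ∞} :
    ContDiffAt ℝ n (ofKSFun M) x :=
  contDiffAt_id.sub ((contDiffAt_timeShift hx h2).smul contDiffAt_const)

/-! ### The pull-back identity -/

/-- **The Eddington–Finkelstein change of time pulls the Kerr–Schild form back to the static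
form**: `g_KS(toKSFun x)(J_x v, J_x w) = g_static(x)(v, w)` at every point with `r ≠ 0`,
`r ≠ 2M`. This is Griffiths–Podolský 2009, (8.5)–(8.6) read backwards:
`−(1 − 2m/r) dv² + 2 dv dr + r² dΩ² = −dt̄² + dr² + r² dΩ² + (2m/r)(dt̄ + dr)²` with `v = t̄ + r`,
`t̄ = t + τ`; in the computation `g_KS` is first moved from `toKSFun x` to `x` by stationarity
(`Kerr.bilin_add_smul_basisVector_zero`). [cite: GriffithsPodolsky2009, §8.2 (8.4)–(8.6)] -/
theorem kerrBilin_jacobian (M : ℝ) {x : E4} (hr : E4.spatialNorm x ≠ 0)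
    (h2 : E4.spatialNorm x - 2 * M ≠ 0) (v w : E4) :
    Kerr.bilin M 0 (toKSFun M x) (jacobian M x v) (jacobian M x w) = staticBilin M x v w := by
  rw [toKSFun, Kerr.bilin_add_smul_basisVector_zero, Kerr.bilin_zero_spin_apply M hr,
    staticBilin_apply, spatial_jacobian, spatial_jacobian, jacobian_apply_zero,
    jacobian_apply_zero, timeShiftDeriv_apply, timeShiftDeriv_apply]
  simp only [nu, sdot]
  field_simp
  ring

/-! ### The chart domain `Kerr.exterior M 0` -/

/-- `2M ≤ r₊(M, 0) = M + |M|`. [folklore] -/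
theorem two_mul_le_rPlus_zero (M : ℝ) : 2 * M ≤ Kerr.rPlus M 0 := by
  have h : Real.sqrt (M ^ 2 - 0 ^ 2) = |M| := by
    rw [show M ^ 2 - 0 ^ 2 = M ^ 2 by ring, Real.sqrt_sq_eq_abs]
  rw [Kerr.rPlus, h]
  linarith [le_abs_self M]

variable {M : ℝ} {x : E4}

/-- On the exterior chart `r > 0`. [folklore] -/
theorem spatialNorm_pos_of_mem (hx : x ∈ Kerr.exterior M 0) : 0 < E4.spatialNorm x := by
  rw [← Kerr.radius_zero_left]
  exact Kerr.radius_pos_of_mem_region hx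

/-- On the exterior chart `x⃗ ≠ 0`. [folklore] -/
theorem spatial_ne_zero_of_mem (hx : x ∈ Kerr.exterior M 0) : E4.spatial x ≠ 0 := by
  have h := spatialNorm_pos_of_mem hx
  rw [E4.spatialNorm, norm_pos_iff] at h
  exact h

/-- On the exterior chart `r > 2M` (for `M ≥ 0` this is `r > r₊ = 2M`; for `M < 0`, `r > 0 > 2M`).
[folklore] -/
theorem two_mul_lt_spatialNorm_of_mem (hx : x ∈ Kerr.exterior M 0) : 2 * M < E4.spatialNorm x := by
  have h := Kerr.lt_radius_of_mem_region hx
  rw [Kerr.radius_zero_left] at h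
  exact (two_mul_le_rPlus_zero M).trans_lt h

/-- On the exterior chart `r − 2M ≠ 0`. [folklore] -/
theorem spatialNorm_sub_ne_zero_of_mem (hx : x ∈ Kerr.exterior M 0) :
    E4.spatialNorm x - 2 * M ≠ 0 :=
  (sub_pos.2 (two_mul_lt_spatialNorm_of_mem hx)).ne'

/-- `toKSFun M` preserves the exterior chart. [cite: GriffithsPodolsky2009, §8.2 p. 111] -/
theorem toKSFun_mem (hx : x ∈ Kerr.exterior M 0) : toKSFun M x ∈ Kerr.exterior M 0 := by
  rw [Kerr.mem_exterior] at hx ⊢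
  rwa [radius_toKSFun]

/-- `ofKSFun M` preserves the exterior chart. [cite: GriffithsPodolsky2009, §8.2 p. 111] -/
theorem ofKSFun_mem (hx : x ∈ Kerr.exterior M 0) : ofKSFun M x ∈ Kerr.exterior M 0 := by
  rw [Kerr.mem_exterior] at hx ⊢
  rwa [radius_ofKSFun]

/-! ### The diffeomorphism and its differential -/

variable (M) in
/-- **The Eddington–Finkelstein change of time as a diffeomorphism of the exterior chart**
`Kerr.exterior M 0 = {‖x⃗‖ > max(r₊, 0)}` onto itself, `(t, x⃗) ↦ (t + 2M log(r − 2M), x⃗)`, from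
the static chart to the ingoing Kerr–Schild chart of the prelude (Griffiths–Podolský 2009, §8.2,
`t̄ = v − r = t + 2m log|r/2m − 1|`, p. 111). [cite: GriffithsPodolsky2009, §8.2 p. 111] -/
def toKerrSchild : Diffeomorph 𝓘(ℝ, E4) 𝓘(ℝ, E4) (Kerr.exterior M 0) (Kerr.exterior M 0) ∞ where
  toFun x := ⟨toKSFun M x, toKSFun_mem x.2⟩
  invFun x := ⟨ofKSFun M x, ofKSFun_mem x.2⟩
  left_inv x := Subtype.ext (ofKSFun_toKSFun M x)
  right_inv x := Subtype.ext (toKSFun_ofKSFun M x)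
  contMDiff_toFun := by
    refine (ContMDiff.subtypeVal_comp_iff _ _).1 fun x ↦ ?_
    exact (OpensChart.contMDiffAt_iff x _ (toKSFun M) (fun _ ↦ rfl)).2
      (contDiffAt_toKSFun (spatial_ne_zero_of_mem x.2) (spatialNorm_sub_ne_zero_of_mem x.2))
  contMDiff_invFun := by
    refine (ContMDiff.subtypeVal_comp_iff _ _).1 fun x ↦ ?_
    exact (OpensChart.contMDiffAt_iff x _ (ofKSFun M) (fun _ ↦ rfl)).2
      (contDiffAt_ofKSFun (spatial_ne_zero_of_mem x.2) (spatialNorm_sub_ne_zero_of_mem x.2))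

/-- `toKerrSchild M x = toKSFun M x` as points of `E4`. [cite: GriffithsPodolsky2009, §8.2 p. 111] -/
@[simp]
theorem coe_toKerrSchild (x : Kerr.exterior M 0) : (toKerrSchild M x : E4) = toKSFun M x := rfl

/-- `(toKerrSchild M).symm x = ofKSFun M x` as points of `E4`. [cite: GriffithsPodolsky2009, §8.2 p. 111] -/
@[simp]
theorem coe_toKerrSchild_symm (x : Kerr.exterior M 0) :
    ((toKerrSchild M).symm x : E4) = ofKSFun M x := rfl

/-- **The differential of the change of time is the Jacobian `J_x`** (the open submanifold
`Kerr.exterior M 0 ⊆ E4` is its own chart). [cite: GriffithsPodolsky2009, §8.2 (8.4)–(8.6)] -/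
theorem mfderiv_toKerrSchild (x : Kerr.exterior M 0) :
    mfderiv 𝓘(ℝ, E4) 𝓘(ℝ, E4) (toKerrSchild M) x = jacobian M x := by
  have hd : MDifferentiableAt 𝓘(ℝ, E4) 𝓘(ℝ, E4) (toKerrSchild M) x :=
    (toKerrSchild M).contMDiff.mdifferentiableAt (by simp)
  have hF := hasFDerivAt_toKSFun (M := M) (spatial_ne_zero_of_mem x.2)
    (spatialNorm_sub_ne_zero_of_mem x.2)
  have h1 : HasMFDerivAt 𝓘(ℝ, E4) 𝓘(ℝ, E4) (Subtype.val ∘ toKerrSchild M) x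
      ((ContinuousLinearMap.id ℝ E4).comp (mfderiv 𝓘(ℝ, E4) 𝓘(ℝ, E4) (toKerrSchild M) x)) :=
    (Literature.Geometry.Manifold.OpenSubmanifold.hasMFDerivAt_subtype_val _).comp x
      hd.hasMFDerivAt
  have h2 : mfderiv 𝓘(ℝ, E4) 𝓘(ℝ, E4) (Subtype.val ∘ toKerrSchild M) x = jacobian M x := by
    have h := OpensChart.mfderiv_eq x (Subtype.val ∘ toKerrSchild M) (toKSFun M) (fun _ ↦ rfl)
      hF.differentiableAt
    rw [hF.fderiv] at h
    exact h
  rw [h1.mfderiv, ContinuousLinearMap.id_comp] at h2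
  exact h2

/-- The differential applied to a vector: `d(toKerrSchild M)_x v = v + dτ(v) ∂_{t*}`. [cite: GriffithsPodolsky2009, §8.2 (8.4)–(8.6)] -/
theorem mfderiv_toKerrSchild_apply (x : Kerr.exterior M 0) (v : E4) :
    mfderiv 𝓘(ℝ, E4) 𝓘(ℝ, E4) (toKerrSchild M) x v = v + timeShiftDeriv M x v • E4.basisVector 0 := by
  rw [mfderiv_toKerrSchild]
  rfl

/-- **`∂_t ↦ ∂_{t*}`** under the change of time: the static Killing field is pushed forward to the
prelude's stationary field `Kerr.stationaryField 0 r₊ = ∂_{t*}`. [cite: GriffithsPodolsky2009, §8.2 p. 111] -/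
theorem mfderiv_toKerrSchild_basisVector_zero (x : Kerr.exterior M 0) :
    mfderiv 𝓘(ℝ, E4) 𝓘(ℝ, E4) (toKerrSchild M) x (E4.basisVector 0) = E4.basisVector 0 := by
  rw [mfderiv_toKerrSchild]
  exact jacobian_basisVector_zero M x

/-- The differential is injective. [cite: GriffithsPodolsky2009, §8.2 (8.4)–(8.6)] -/
theorem mfderiv_toKerrSchild_injective (x : Kerr.exterior M 0) :
    Function.Injective (mfderiv 𝓘(ℝ, E4) 𝓘(ℝ, E4) (toKerrSchild M) x) := by
  rw [mfderiv_toKerrSchild]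
  exact jacobian_injective M x

/-- **`(toKerrSchild M)^* g_KS = g_static`**: the pull-back of the Kerr–Schild components
`Kerr.bilin M 0` of the Schwarzschild metric along the change of time is the static form, at
every point of the exterior chart and for every real `M`. Griffiths–Podolský 2009, (8.1) and
(8.4)–(8.6). [cite: GriffithsPodolsky2009, §8.2 (8.4)–(8.6)] -/
theorem pullbackBilin_toKerrSchild (x : Kerr.exterior M 0) :
    pullbackBilin (I := 𝓘(ℝ, E4)) (I' := 𝓘(ℝ, E4)) (toKerrSchild M)
        (fun y : Kerr.exterior M 0 ↦ Kerr.bilin M 0 (y : E4)) x = staticBilin M x := by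
  ext v w
  rw [pullbackBilin_apply, mfderiv_toKerrSchild]
  exact kerrBilin_jacobian M (spatialNorm_pos_of_mem x.2).ne' (spatialNorm_sub_ne_zero_of_mem x.2) v w

/-! ### The static metric as a Lorentzian metric; the isometry -/

/-- `toKerrSchild M` is of class `C^{∞ + 1} = C^∞` (the regularity asked by
`LorentzianMetric.comap`). [folklore] -/
theorem contMDiff_toKerrSchild_add_one :
    ContMDiff 𝓘(ℝ, E4) 𝓘(ℝ, E4) (∞ + 1) (toKerrSchild M) := by
  have h : ((∞ : ℕ∞ω) + 1) = ∞ := rfl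
  rw [h]
  exact (toKerrSchild M).contMDiff

variable (M) in
/-- **The Schwarzschild exterior in static coordinates** as a `C^∞` Lorentzian metric on the chart
domain `Kerr.exterior M 0 = {‖x⃗‖ > max(r₊, 0)}`: the pull-back of the prelude's Kerr–Schild
Schwarzschild metric `Kerr.smoothMetric M 0 r₊` along the change of time `toKerrSchild M`
(`LorentzianMetric.comap`; smoothness of pull-backs is `contMDiff_pullbackBilin_holds`). Its value
at `x` is the static form `staticBilin M x` (`staticMetric_val`). Griffiths–Podolský 2009, (8.1);
O'Neill 1983, Ch. 3, pp. 90–91. [cite: GriffithsPodolsky2009, §8.1 (8.1)] -/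
def staticMetric [Kerr.Facts] : LorentzianMetric 𝓘(ℝ, E4) ∞ (Kerr.exterior M 0) :=
  (Kerr.smoothMetric M 0 (Kerr.rPlus M 0)).comap PseudoRiemannianMetric.contMDiff_pullbackBilin_holds
    (toKerrSchild M) contMDiff_toKerrSchild_add_one mfderiv_toKerrSchild_injective rfl

/-- **The value of the static metric is the static form** `−(1 − 2M/r) dt² + dx⃗² + (2M/(r − 2M)) dr²`.
Griffiths–Podolský 2009, (8.1). [cite: GriffithsPodolsky2009, §8.1 (8.1)] -/
@[simp]
theorem staticMetric_val [Kerr.Facts] (x : Kerr.exterior M 0) :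
    (staticMetric M).val x = staticBilin M x :=
  pullbackBilin_toKerrSchild x

/-- **The change of time is an isometry of the static Schwarzschild exterior onto the Kerr–Schild
Schwarzschild exterior**: `(toKerrSchild M)^* g_KS = g_static` (O'Neill 1983, Ch. 3, Def. 3.4;
Griffiths–Podolský 2009, §8.2). [cite: GriffithsPodolsky2009, §8.2 (8.4)–(8.6)] -/
theorem isIsometry_toKerrSchild [Kerr.Facts] :
    PseudoRiemannianMetric.IsIsometry (staticMetric M).toPseudoRiemannianMetric
      (Kerr.smoothMetric M 0 (Kerr.rPlus M 0)).toPseudoRiemannianMetric (toKerrSchild M) :=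
  fun _ ↦ rfl

/-- **How the file is used**: a diffeomorphism `Ψ` of a space-time region `(N, g_N)` onto the
static chart which is an isometry for the static form, `Ψ^* g_static = g_N`, composed with the
change of time, is an isometry onto the Kerr–Schild Schwarzschild exterior
`(Kerr.exterior M 0, Kerr.smoothMetric M 0 r₊)` — the shape demanded by
`StationaryAFBlackHole.IsIsometricToSchwarzschildExterior`. O'Neill 1983, Ch. 3, Def. 3.4;
Griffiths–Podolský 2009, §8.2. [cite: GriffithsPodolsky2009, §8.2 (8.4)–(8.6)] -/
theorem isIsometry_trans_toKerrSchild [Kerr.Facts] {EN HN : Type*} [NormedAddCommGroup EN]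
    [NormedSpace ℝ EN] [TopologicalSpace HN] {IN : ModelWithCorners ℝ EN HN} {N : Type*}
    [TopologicalSpace N] [ChartedSpace HN N] [IsManifold IN ∞ N]
    {gN : PseudoRiemannianMetric IN ∞ EN (TangentSpace IN : N → Type _)}
    {Ψ : Diffeomorph IN 𝓘(ℝ, E4) N (Kerr.exterior M 0) ∞}
    (hΨ : PseudoRiemannianMetric.IsIsometry gN (staticMetric M).toPseudoRiemannianMetric Ψ) :
    PseudoRiemannianMetric.IsIsometry gN
      (Kerr.smoothMetric M 0 (Kerr.rPlus M 0)).toPseudoRiemannianMetric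
      (Ψ.trans (toKerrSchild M)) :=
  hΨ.trans (by simp) isIsometry_toKerrSchild

/-- In the static metric the Killing field `∂_t` is timelike on the whole exterior chart:
`g_static(∂_t, ∂_t) = −(1 − 2M/r) < 0`. Griffiths–Podolský 2009, §8.1. [cite: GriffithsPodolsky2009, §8.1 (8.1)] -/
theorem staticMetric_basisVector_zero_zero_neg [Kerr.Facts] (x : Kerr.exterior M 0) :
    (staticMetric M).val x (E4.basisVector 0) (E4.basisVector 0) < 0 := by
  rw [staticMetric_val]
  exact staticBilin_basisVector_zero_zero_neg M (spatialNorm_pos_of_mem x.2)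
    (two_mul_lt_spatialNorm_of_mem x.2)

/-- In the static metric `∂_t` is orthogonal to the slices `{t = const}` of the chart:
`g_static(∂_t, w) = 0` whenever `w⁰ = 0`. Griffiths–Podolský 2009, (8.1). [cite: GriffithsPodolsky2009, §8.1 (8.1)] -/
theorem staticMetric_basisVector_zero_eq_zero [Kerr.Facts] (x : Kerr.exterior M 0) {w : E4}
    (hw : w 0 = 0) : (staticMetric M).val x (E4.basisVector 0) w = 0 := by
  have h := staticBilin_basisVector_zero_left M x w
  rw [hw, mul_zero, neg_zero] at h
  rw [staticMetric_val]
  exact h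

/-! ### Isotropic coordinates (Baumgarte–Shapiro 2021, Exercise 1.5)

The classification theorems for static vacuum black holes that go through the positive energy
theorem (Bunting–Masood-ul-Alam 1987; Chruściel–Costa 2008, Thm. 1.4) end with a conformally FLAT
`3`-metric, i.e. with the Schwarzschild metric in **isotropic** coordinates `(t, y⃗)`, `ρ = ‖y⃗‖`:
`g_iso = −((1 − M/2ρ)/(1 + M/2ρ))² dt² + (1 + M/2ρ)⁴ dy⃗²` on `{ρ > M/2}` (Baumgarte–Shapiro 2021,
Exercise 1.5, (1.44)–(1.45); Exercise 2.19, (2.109): areal radius `R = r (1 + M/2r)²`). We realise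
this chart on `Schwarzschild.isotropicRegion M = {ρ > max(M/2, 0)} ⊆ E4`, the change of radius
`Schwarzschild.toStaticFun M (t, y⃗) = (t, (1 + M/2ρ)² y⃗)` onto the static chart `Kerr.exterior M 0`
(inverse `ofStaticFun`, `ρ = (r − M + √(r(r − 2M)))/2`), its Jacobian and the pull-back identity
`(toStaticFun)^* g_static = g_iso`, and, for `M ≥ 0`, the diffeomorphism `Schwarzschild.ofIsotropic`,
the metric `Schwarzschild.isotropicMetric := comap` and the isometries onto the static and the
Kerr–Schild charts. -/

/-- `∂_{t}` has no spatial part (the same statement is `E4.spatial_basisVector_zero` of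
`KerrHyperboloidalLeaves.lean`, deliberately not imported: it would drag the wave-equation tower into
the import closure of this chart file; TODO(librarian): hoist it to `Basic.lean`). [folklore] -/
private theorem spatial_basisVector_zero : E4.spatial (E4.basisVector 0) = 0 := by
  ext i
  simp [E4.spatial_apply, Fin.succ_ne_zero]

/-- The spatial projection `v ↦ (0, v⃗) = v − v⁰ ∂₀` as a continuous linear map of `E4`. [folklore] -/
def sproj : E4 →L[ℝ] E4 :=
  ContinuousLinearMap.id ℝ E4 - (E4.dx 0).smulRight (E4.basisVector 0)

/-- `sproj v = v − v⁰ ∂₀`. [folklore] -/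
theorem sproj_apply (v : E4) : sproj v = v - v 0 • E4.basisVector 0 := rfl

/-- `(sproj v)⁰ = 0`. [folklore] -/
@[simp]
theorem sproj_apply_zero (v : E4) : sproj v 0 = 0 := by
  simp [sproj_apply]

/-- `(sproj v)⃗ = v⃗`. [folklore] -/
@[simp]
theorem spatial_sproj (v : E4) : E4.spatial (sproj v) = E4.spatial v := by
  rw [sproj_apply, map_sub, map_smul, spatial_basisVector_zero, smul_zero, sub_zero]

/-- The **conformal factor** `ψ = 1 + M/(2ρ)`, `ρ = ‖y⃗‖`, of the isotropic form
(Baumgarte–Shapiro 2021, Exercise 1.5, (1.44)–(1.45)). [cite: BaumgarteShapiro2021, Exercise 1.5 (1.44)–(1.45)] -/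
def isoPsi (M : ℝ) (y : E4) : ℝ := 1 + M / (2 * E4.spatialNorm y)

/-- The numerator `φ = 1 − M/(2ρ)` of the isotropic lapse `V = φ/ψ`
(Baumgarte–Shapiro 2021, (1.45)). [cite: BaumgarteShapiro2021, Exercise 1.5 (1.45)] -/
def isoPhi (M : ℝ) (y : E4) : ℝ := 1 - M / (2 * E4.spatialNorm y)

/-- **The Schwarzschild metric in isotropic Cartesian coordinates** `(t, y⃗)`:
`g_iso = −(φ/ψ)² dt² + ψ⁴ dy⃗²`, `ψ = 1 + M/2ρ`, `φ = 1 − M/2ρ` (Baumgarte–Shapiro 2021, (1.45) =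
(2.109), with `dr² + r² dΩ² = dy⃗²`, "in Cartesian coordinates `η_{ij} = δ_{ij}`"). A continuous
bilinear form on `E4` for every `y` (junk where `ρ = 0` or `ψ = 0`). [cite: BaumgarteShapiro2021, Exercise 1.5 (1.45); Exercise 2.19 (2.109)] -/
def isotropicBilin (M : ℝ) (y : E4) : E4 →L[ℝ] E4 →L[ℝ] ℝ :=
  isoPsi M y ^ 4 • (Minkowski.bilin + E4.tmul (E4.dx 0) (E4.dx 0)) -
    (isoPhi M y / isoPsi M y) ^ 2 • E4.tmul (E4.dx 0) (E4.dx 0)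

/-- `g_iso(v, w) = −(φ/ψ)² v⁰w⁰ + ψ⁴ ⟪v⃗, w⃗⟫`. [cite: BaumgarteShapiro2021, Exercise 1.5 (1.45)] -/
theorem isotropicBilin_apply (M : ℝ) (y v w : E4) :
    isotropicBilin M y v w =
      -((isoPhi M y / isoPsi M y) ^ 2 * (v 0 * w 0)) + isoPsi M y ^ 4 * sdot v w := by
  have hdx : ∀ u : E4, E4.dx 0 u = u 0 := fun u ↦ rfl
  simp only [isotropicBilin, sub_apply, add_apply, smul_apply, E4.tmul_apply,
    hdx, smul_eq_mul, Kerr.minkowski_bilin_eq_spatial]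
  rw [← sdot]
  ring

/-- The isotropic form is symmetric. [cite: BaumgarteShapiro2021, Exercise 1.5 (1.45)] -/
theorem isotropicBilin_symm (M : ℝ) (y v w : E4) :
    isotropicBilin M y v w = isotropicBilin M y w v := by
  rw [isotropicBilin_apply, isotropicBilin_apply, sdot_comm v w]
  ring

/-- `g_iso(∂_t, w) = −(φ/ψ)² w⁰`: `∂_t` is orthogonal to the isotropic slices `{t = const}` and
`g_iso(∂_t, ∂_t) = −(φ/ψ)²`. [cite: BaumgarteShapiro2021, Exercise 2.19 (2.109)] -/
theorem isotropicBilin_basisVector_zero_left (M : ℝ) (y w : E4) :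
    isotropicBilin M y (E4.basisVector 0) w = -((isoPhi M y / isoPsi M y) ^ 2 * w 0) := by
  rw [isotropicBilin_apply]
  simp [sdot, spatial_basisVector_zero]

/-- **From isotropic to areal (static) coordinates**: `(t, y⃗) ↦ (t, ψ² y⃗)`, i.e. `x⃗ = r n̂` with
the areal radius `r = ρ ψ² = ρ (1 + M/2ρ)²` (Baumgarte–Shapiro 2021, (1.44): `R = r(1 + M/2r)²`).
[cite: BaumgarteShapiro2021, Exercise 1.5 (1.44)] -/
def toStaticFun (M : ℝ) (y : E4) : E4 := y + (isoPsi M y ^ 2 - 1) • sproj y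

/-- The time coordinate is unchanged. [cite: BaumgarteShapiro2021, Exercise 1.5 (1.44)] -/
@[simp]
theorem toStaticFun_apply_zero (M : ℝ) (y : E4) : toStaticFun M y 0 = y 0 := by
  simp [toStaticFun]

/-- The spatial part is rescaled: `(toStaticFun M y)⃗ = ψ² y⃗`. [cite: BaumgarteShapiro2021, Exercise 1.5 (1.44)] -/
theorem spatial_toStaticFun (M : ℝ) (y : E4) :
    E4.spatial (toStaticFun M y) = isoPsi M y ^ 2 • E4.spatial y := by
  rw [toStaticFun, map_add, map_smul, spatial_sproj]
  module

/-- `⟪(toStaticFun M y)⃗, u⃗⟫ = ψ² ⟪y⃗, u⃗⟫`. [cite: BaumgarteShapiro2021, Exercise 1.5 (1.44)] -/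
theorem sdot_toStaticFun_left (M : ℝ) (y u : E4) :
    sdot (toStaticFun M y) u = isoPsi M y ^ 2 * sdot y u := by
  rw [sdot, spatial_toStaticFun, inner_smul_left, sdot]
  simp

/-- **The areal radius** `r = ‖(toStaticFun M y)⃗‖ = ψ² ρ`. [cite: BaumgarteShapiro2021, Exercise 1.5 (1.44)] -/
theorem spatialNorm_toStaticFun (M : ℝ) (y : E4) :
    E4.spatialNorm (toStaticFun M y) = isoPsi M y ^ 2 * E4.spatialNorm y := by
  rw [E4.spatialNorm, spatial_toStaticFun, norm_smul, Real.norm_eq_abs, abs_of_nonneg (sq_nonneg _),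
    E4.spatialNorm]

/-- `r − 2M = ρ φ²` (`ρ ≠ 0`): the horizon `r = 2M` is `ρ = M/2`. [cite: BaumgarteShapiro2021, Exercise 1.7] -/
theorem spatialNorm_toStaticFun_sub (M : ℝ) {y : E4} (hρ : E4.spatialNorm y ≠ 0) :
    E4.spatialNorm (toStaticFun M y) - 2 * M = E4.spatialNorm y * isoPhi M y ^ 2 := by
  rw [spatialNorm_toStaticFun, isoPsi, isoPhi]
  field_simp
  ring

/-- The derivative `d(ψ² − 1) = −(Mψ/ρ³) ⟪y⃗, ·⟫` of the radial rescaling factor, as a covector.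
[cite: BaumgarteShapiro2021, Exercise 1.5 (1.44)] -/
def isoCoeffDeriv (M : ℝ) (y : E4) : E4 →L[ℝ] ℝ :=
  (-(M * isoPsi M y) / E4.spatialNorm y ^ 3) • sdotCLM y

/-- `d(ψ² − 1)(v) = −(Mψ/ρ³) ⟪y⃗, v⃗⟫`. [cite: BaumgarteShapiro2021, Exercise 1.5 (1.44)] -/
theorem isoCoeffDeriv_apply (M : ℝ) (y v : E4) :
    isoCoeffDeriv M y v = -(M * isoPsi M y) / E4.spatialNorm y ^ 3 * sdot y v := by
  simp only [isoCoeffDeriv, smul_apply, sdotCLM_apply, smul_eq_mul]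

/-- **The Jacobian of the change of radius**: `J_y v = v + (ψ² − 1)(0, v⃗) + d(ψ²)(v) (0, y⃗)`, i.e.
`(J v)⁰ = v⁰`, `(J v)⃗ = ψ² v⃗ − (Mψ/ρ³)⟪y⃗, v⃗⟫ y⃗`. [cite: BaumgarteShapiro2021, Exercise 1.5 (1.44)] -/
def isoJacobian (M : ℝ) (y : E4) : E4 →L[ℝ] E4 :=
  ContinuousLinearMap.id ℝ E4 +
    ((isoPsi M y ^ 2 - 1) • sproj + (isoCoeffDeriv M y).smulRight (sproj y))

/-- `J_y v = v + (ψ² − 1) sproj v + d(ψ²)(v) sproj y`. [cite: BaumgarteShapiro2021, Exercise 1.5 (1.44)] -/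
theorem isoJacobian_apply (M : ℝ) (y v : E4) :
    isoJacobian M y v = v + ((isoPsi M y ^ 2 - 1) • sproj v + isoCoeffDeriv M y v • sproj y) := rfl

/-- The time component is unchanged: `(J v)⁰ = v⁰`. [cite: BaumgarteShapiro2021, Exercise 1.5 (1.44)] -/
@[simp]
theorem isoJacobian_apply_zero (M : ℝ) (y v : E4) : isoJacobian M y v 0 = v 0 := by
  rw [isoJacobian_apply]
  simp

/-- The spatial part: `(J v)⃗ = ψ² v⃗ + d(ψ²)(v) y⃗`. [cite: BaumgarteShapiro2021, Exercise 1.5 (1.44)] -/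
theorem spatial_isoJacobian (M : ℝ) (y v : E4) :
    E4.spatial (isoJacobian M y v) = isoPsi M y ^ 2 • E4.spatial v + isoCoeffDeriv M y v • E4.spatial y := by
  rw [isoJacobian_apply, map_add, map_add, map_smul, map_smul, spatial_sproj, spatial_sproj]
  module

/-- `J_y ∂_t = ∂_t`: the static Killing field is unchanged. [cite: BaumgarteShapiro2021, Exercise 2.19 (2.109)] -/
theorem isoJacobian_basisVector_zero (M : ℝ) (y : E4) :
    isoJacobian M y (E4.basisVector 0) = E4.basisVector 0 := by
  have h1 : sproj (E4.basisVector 0) = 0 := by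
    rw [sproj_apply]
    simp
  have h2 : isoCoeffDeriv M y (E4.basisVector 0) = 0 := by
    rw [isoCoeffDeriv_apply, sdot, spatial_basisVector_zero, inner_zero_right, mul_zero]
  rw [isoJacobian_apply, h1, h2, smul_zero, zero_smul, add_zero, add_zero]

/-- `⟪y⃗, (J v)⃗⟫ = ψ φ ⟪y⃗, v⃗⟫` (`ρ ≠ 0`). [cite: BaumgarteShapiro2021, Exercise 1.5 (1.44)] -/
theorem sdot_isoJacobian_left (M : ℝ) {y : E4} (hρ : E4.spatialNorm y ≠ 0) (v : E4) :
    sdot y (isoJacobian M y v) = isoPsi M y * isoPhi M y * sdot y v := by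
  rw [sdot, spatial_isoJacobian, inner_add_right, inner_smul_right, inner_smul_right,
    real_inner_self_eq_norm_sq, isoCoeffDeriv_apply, ← E4.spatialNorm, ← sdot, isoPsi, isoPhi]
  field_simp
  ring

/-- `⟪(J v)⃗, (J w)⃗⟫ = ψ⁴ ⟪v⃗, w⃗⟫ + (ψ² d(ψ²)(w) + ψ² d(ψ²)(v)… )`, in closed form:
`ψ⁴ ⟪v⃗, w⃗⟫ + (M²ψ²/ρ⁴ − 2Mψ³/ρ³) ⟪y⃗, v⃗⟫⟪y⃗, w⃗⟫` (`ρ ≠ 0`). [cite: BaumgarteShapiro2021, Exercise 1.5 (1.44)] -/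
theorem sdot_isoJacobian (M : ℝ) {y : E4} (hρ : E4.spatialNorm y ≠ 0) (v w : E4) :
    sdot (isoJacobian M y v) (isoJacobian M y w) =
      isoPsi M y ^ 4 * sdot v w +
        (M ^ 2 * isoPsi M y ^ 2 / E4.spatialNorm y ^ 4 - 2 * M * isoPsi M y ^ 3 / E4.spatialNorm y ^ 3) *
          (sdot y v * sdot y w) := by
  have hρ' : ‖E4.spatial y‖ ≠ 0 := hρ
  simp only [sdot, spatial_isoJacobian, inner_add_left, inner_add_right, inner_smul_left,
    inner_smul_right, real_inner_self_eq_norm_sq, conj_trivial, isoCoeffDeriv_apply, E4.spatialNorm]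
  rw [real_inner_comm (E4.spatial y) (E4.spatial v)]
  field_simp
  ring

/-- **The change of radius pulls the static form back to the isotropic form**:
`g_static(toStaticFun y)(J_y v, J_y w) = g_iso(y)(v, w)` wherever `ρ ≠ 0`, `ψ ≠ 0`, `φ ≠ 0`
(Baumgarte–Shapiro 2021, Exercise 1.5: (1.38) becomes (1.45) under (1.44)). The radial term of
`g_static` and the cross terms of `⟪J v⃗, J w⃗⟫` cancel exactly, leaving `ψ⁴ ⟪v⃗, w⃗⟫`, and
`1 − 2M/r = φ²/ψ²`. [cite: BaumgarteShapiro2021, Exercise 1.5 (1.44)–(1.45)] -/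
theorem staticBilin_isoJacobian (M : ℝ) {y : E4} (hρ : E4.spatialNorm y ≠ 0) (hψ : isoPsi M y ≠ 0)
    (hφ : isoPhi M y ≠ 0) (v w : E4) :
    staticBilin M (toStaticFun M y) (isoJacobian M y v) (isoJacobian M y w) = isotropicBilin M y v w := by
  have hψ' : 2 * E4.spatialNorm y + M ≠ 0 := by
    intro h
    apply hψ
    rw [isoPsi]
    field_simp
    linarith
  have hφ' : 2 * E4.spatialNorm y - M ≠ 0 := by
    intro h
    apply hφ
    rw [isoPhi]
    field_simp
    linarith
  rw [staticBilin_apply, spatialNorm_toStaticFun_sub M hρ, nu, nu, sdot_toStaticFun_left,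
    sdot_toStaticFun_left, sdot_isoJacobian_left M hρ, sdot_isoJacobian_left M hρ,
    spatialNorm_toStaticFun, sdot_isoJacobian M hρ, isoJacobian_apply_zero, isoJacobian_apply_zero,
    isotropicBilin_apply]
  simp only [isoPsi, isoPhi] at hψ hφ ⊢
  field_simp
  ring

/-- Two points of `E4` with the same time and space components are equal (a Summits-side file
states the same lemma; `Literature` cannot import `Summits`, TODO(librarian): hoist to `Basic.lean`).
[folklore] -/
private theorem E4_eq_of_apply_zero_of_spatial {a b : E4} (h0 : a 0 = b 0)
    (hs : E4.spatial a = E4.spatial b) : a = b := by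
  rw [← E4.ofTimeSpace_time_spatial a, ← E4.ofTimeSpace_time_spatial b]
  simp only [E4.time, hs, h0]

/-- The Jacobian of the change of radius is injective (`ρ ≠ 0`, `ψ ≠ 0`, `φ ≠ 0`): pairing
`(J v)⃗ = 0` with `y⃗` gives `ψφ ⟪y⃗, v⃗⟫ = 0`, whence `ψ² v⃗ = 0`. [cite: BaumgarteShapiro2021, Exercise 1.5 (1.44)] -/
theorem isoJacobian_injective (M : ℝ) {y : E4} (hρ : E4.spatialNorm y ≠ 0) (hψ : isoPsi M y ≠ 0)
    (hφ : isoPhi M y ≠ 0) : Function.Injective (isoJacobian M y) := by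
  refine (injective_iff_map_eq_zero _).2 fun v hv ↦ ?_
  have h0 : v 0 = 0 := by
    have := congrArg (fun u : E4 ↦ u 0) hv
    simpa using this
  have h1 : sdot y v = 0 := by
    have h := sdot_isoJacobian_left M hρ v
    have hz : sdot y (isoJacobian M y v) = 0 := by
      rw [hv, sdot, map_zero, inner_zero_right]
    rw [hz] at h
    exact (mul_eq_zero.1 h.symm).resolve_left (mul_ne_zero hψ hφ)
  have h2 : E4.spatial v = 0 := by
    have h := spatial_isoJacobian M y v
    rw [hv, map_zero, isoCoeffDeriv_apply, h1, mul_zero, zero_smul, add_zero] at h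
    exact (smul_eq_zero.1 h.symm).resolve_left (pow_ne_zero 2 hψ)
  exact E4_eq_of_apply_zero_of_spatial (by simpa using h0) (by rw [h2, map_zero])

/-! ### Isotropic coordinates: derivatives and smoothness -/

/-- `Dψ(y) = −(M/(2ρ³)) ⟪y⃗, ·⟫` off the time axis. [cite: BaumgarteShapiro2021, Exercise 1.5 (1.44)] -/
theorem hasFDerivAt_isoPsi {M : ℝ} {y : E4} (hy : E4.spatial y ≠ 0) :
    HasFDerivAt (isoPsi M) ((-(M / (2 * E4.spatialNorm y ^ 3))) • sdotCLM y) y := by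
  have hρ : E4.spatialNorm y ≠ 0 := by simpa [E4.spatialNorm] using hy
  have hfun : isoPsi M = fun z ↦ 1 + M / 2 * (E4.spatialNorm z)⁻¹ := by
    funext z
    rw [isoPsi]
    ring
  have hs : HasDerivAt (fun r : ℝ ↦ 1 + M / 2 * r⁻¹) (M / 2 * (-(E4.spatialNorm y ^ 2)⁻¹))
      (E4.spatialNorm y) :=
    ((hasDerivAt_inv hρ).const_mul (M / 2)).const_add 1
  have h := hs.comp_hasFDerivAt y (hasFDerivAt_spatialNorm hy)
  rw [hfun]
  refine h.congr_fderiv ?_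
  rw [smul_smul]
  congr 1
  field_simp

/-- `D(ψ² − 1)(y) = isoCoeffDeriv M y` off the time axis. [cite: BaumgarteShapiro2021, Exercise 1.5 (1.44)] -/
theorem hasFDerivAt_isoPsi_sq_sub_one {M : ℝ} {y : E4} (hy : E4.spatial y ≠ 0) :
    HasFDerivAt (fun z ↦ isoPsi M z ^ 2 - 1) (isoCoeffDeriv M y) y := by
  have hρ : E4.spatialNorm y ≠ 0 := by simpa [E4.spatialNorm] using hy
  have h := ((hasFDerivAt_isoPsi (M := M) hy).pow 2).sub_const (1 : ℝ)
  refine h.congr_fderiv ?_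
  rw [isoCoeffDeriv, smul_smul]
  congr 1
  push_cast
  field_simp
  ring

/-- `D(toStaticFun M)(y) = J_y` off the time axis. [cite: BaumgarteShapiro2021, Exercise 1.5 (1.44)] -/
theorem hasFDerivAt_toStaticFun {M : ℝ} {y : E4} (hy : E4.spatial y ≠ 0) :
    HasFDerivAt (toStaticFun M) (isoJacobian M y) y :=
  (hasFDerivAt_id y).add ((hasFDerivAt_isoPsi_sq_sub_one hy).smul sproj.hasFDerivAt)

/-- `ψ` is smooth off the time axis. [cite: BaumgarteShapiro2021, Exercise 1.5 (1.44)] -/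
theorem contDiffAt_isoPsi {M : ℝ} {y : E4} (hy : E4.spatial y ≠ 0) {n : WithTop ℕ∞} :
    ContDiffAt ℝ n (isoPsi M) y := by
  have hρ : E4.spatialNorm y ≠ 0 := by simpa [E4.spatialNorm] using hy
  have h1 : ContDiffAt ℝ n E4.spatialNorm y :=
    (contDiffAt_norm ℝ hy).comp y E4.spatial.contDiff.contDiffAt
  exact contDiffAt_const.add (contDiffAt_const.div (contDiffAt_const.mul h1)
    (mul_ne_zero two_ne_zero hρ))

/-- `toStaticFun M` is smooth off the time axis. [cite: BaumgarteShapiro2021, Exercise 1.5 (1.44)] -/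
theorem contDiffAt_toStaticFun {M : ℝ} {y : E4} (hy : E4.spatial y ≠ 0) {n : WithTop ℕ∞} :
    ContDiffAt ℝ n (toStaticFun M) y :=
  contDiffAt_id.add ((((contDiffAt_isoPsi hy).pow 2).sub contDiffAt_const).smul
    sproj.contDiff.contDiffAt)

/-! ### Isotropic coordinates: the inverse change of radius -/

/-- **The isotropic radius as a function of the areal radius**: `ρ(r) = (r − M + √(r(r − 2M)))/2`,
the root `ρ > M/2` of `r = ρ(1 + M/2ρ)²` (Baumgarte–Shapiro 2021, Exercise 1.5 (b): "real
solutions for `r` exist only for `R ≥ 2M`"). [cite: BaumgarteShapiro2021, Exercise 1.5 (b)] -/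
def isoRadius (M r : ℝ) : ℝ := (r - M + Real.sqrt (r * (r - 2 * M))) / 2

/-- `ρ(ρψ²) = ρ` for `ρ > 0` with `ψ, φ ≥ 0`. [cite: BaumgarteShapiro2021, Exercise 1.5 (b)] -/
theorem isoRadius_areal {M ρ : ℝ} (hρ : 0 < ρ) (hψ : 0 ≤ 1 + M / (2 * ρ)) (hφ : 0 ≤ 1 - M / (2 * ρ)) :
    isoRadius M ((1 + M / (2 * ρ)) ^ 2 * ρ) = ρ := by
  have key : (1 + M / (2 * ρ)) ^ 2 * ρ * ((1 + M / (2 * ρ)) ^ 2 * ρ - 2 * M) =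
      (ρ * (1 + M / (2 * ρ)) * (1 - M / (2 * ρ))) ^ 2 := by
    field_simp
    ring
  rw [isoRadius, key, Real.sqrt_sq (by positivity)]
  field_simp
  ring

/-- For `r > 2M`: `ρ(r) > M/2`. [cite: BaumgarteShapiro2021, Exercise 1.5 (b)] -/
theorem half_lt_isoRadius {M r : ℝ} (hr : 2 * M < r) : M / 2 < isoRadius M r := by
  rw [isoRadius]
  have hs : 0 ≤ Real.sqrt (r * (r - 2 * M)) := Real.sqrt_nonneg _
  linarith

/-- For `r > 2M ≥ 0`: `ρ(r) > 0`. [cite: BaumgarteShapiro2021, Exercise 1.5 (b)] -/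
theorem isoRadius_pos {M r : ℝ} (hM : 0 ≤ M) (hr : 2 * M < r) : 0 < isoRadius M r :=
  lt_of_le_of_lt (by linarith) (half_lt_isoRadius hr)

/-- **`ρ(r)` solves `r = ρ (1 + M/2ρ)²`** for `r > 2M ≥ 0`. [cite: BaumgarteShapiro2021, Exercise 1.5 (1.44)] -/
theorem areal_isoRadius {M r : ℝ} (hM : 0 ≤ M) (hr : 2 * M < r) :
    (1 + M / (2 * isoRadius M r)) ^ 2 * isoRadius M r = r := by
  have hρ : isoRadius M r ≠ 0 := (isoRadius_pos hM hr).ne'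
  have hs : Real.sqrt (r * (r - 2 * M)) ^ 2 = r * (r - 2 * M) := Real.sq_sqrt (by nlinarith)
  have hq : 4 * isoRadius M r ^ 2 - 4 * (r - M) * isoRadius M r + M ^ 2 = 0 := by
    rw [isoRadius]
    linear_combination hs
  have h4 : (1 + M / (2 * isoRadius M r)) ^ 2 * isoRadius M r =
      (4 * isoRadius M r ^ 2 + 4 * M * isoRadius M r + M ^ 2) / (4 * isoRadius M r) := by
    field_simp
    ring
  rw [h4, div_eq_iff (by positivity)]
  linear_combination hq

/-- **From areal (static) to isotropic coordinates**: `(t, x⃗) ↦ (t, (ρ(r)/r) x⃗)`.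
[cite: BaumgarteShapiro2021, Exercise 1.5 (b)] -/
def ofStaticFun (M : ℝ) (x : E4) : E4 :=
  x + (isoRadius M (E4.spatialNorm x) / E4.spatialNorm x - 1) • sproj x

/-- The time coordinate is unchanged. [cite: BaumgarteShapiro2021, Exercise 1.5 (b)] -/
@[simp]
theorem ofStaticFun_apply_zero (M : ℝ) (x : E4) : ofStaticFun M x 0 = x 0 := by
  simp [ofStaticFun]

/-- `(ofStaticFun M x)⃗ = (ρ(r)/r) x⃗`. [cite: BaumgarteShapiro2021, Exercise 1.5 (b)] -/
theorem spatial_ofStaticFun (M : ℝ) (x : E4) :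
    E4.spatial (ofStaticFun M x) =
      (isoRadius M (E4.spatialNorm x) / E4.spatialNorm x) • E4.spatial x := by
  rw [ofStaticFun, map_add, map_smul, spatial_sproj]
  module

/-- `‖(ofStaticFun M x)⃗‖ = ρ(r)` (`r > 0`, `ρ(r) ≥ 0`). [cite: BaumgarteShapiro2021, Exercise 1.5 (b)] -/
theorem spatialNorm_ofStaticFun (M : ℝ) {x : E4} (hr : 0 < E4.spatialNorm x)
    (hρ : 0 ≤ isoRadius M (E4.spatialNorm x)) :
    E4.spatialNorm (ofStaticFun M x) = isoRadius M (E4.spatialNorm x) := by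
  rw [E4.spatialNorm, spatial_ofStaticFun, norm_smul, Real.norm_eq_abs,
    abs_of_nonneg (div_nonneg hρ hr.le), ← E4.spatialNorm, div_mul_cancel₀ _ hr.ne']

/-- `ofStaticFun M` is smooth on `{r > 2M}` off the time axis (`M ≥ 0`). [cite: BaumgarteShapiro2021, Exercise 1.5 (b)] -/
theorem contDiffAt_ofStaticFun {M : ℝ} {x : E4} (hx : E4.spatial x ≠ 0)
    (hr : 2 * M < E4.spatialNorm x) {n : WithTop ℕ∞} : ContDiffAt ℝ n (ofStaticFun M) x := by
  have hr0 : 0 < E4.spatialNorm x := by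
    rw [E4.spatialNorm, norm_pos_iff]
    exact hx
  have h1 : ContDiffAt ℝ n E4.spatialNorm x :=
    (contDiffAt_norm ℝ hx).comp x E4.spatial.contDiff.contDiffAt
  have h2 : ContDiffAt ℝ n (fun z ↦ isoRadius M (E4.spatialNorm z)) x :=
    ((h1.sub contDiffAt_const).add ((h1.mul (h1.sub contDiffAt_const)).sqrt
      (mul_pos hr0 (by linarith)).ne')).div_const 2
  exact contDiffAt_id.add (((h2.div h1 hr0.ne').sub contDiffAt_const).smul sproj.contDiff.contDiffAt)

/-! ### Isotropic coordinates: the chart domain and the diffeomorphism -/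

/-- **The isotropic chart domain** `{(t, y⃗) | ‖y⃗‖ > max(M/2, 0)}` (for `M > 0`: outside the
horizon `ρ = M/2`, Baumgarte–Shapiro 2021, Exercise 1.7). [cite: BaumgarteShapiro2021, Exercise 1.5, Exercise 1.7] -/
def isotropicRegion (M : ℝ) : Opens E4 :=
  ⟨{y | max (M / 2) 0 < E4.spatialNorm y},
    isOpen_lt continuous_const (continuous_norm.comp E4.spatial.continuous)⟩

/-- Membership in the isotropic chart domain. [cite: BaumgarteShapiro2021, Exercise 1.5] -/
@[simp]
theorem mem_isotropicRegion {M : ℝ} {y : E4} :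
    y ∈ isotropicRegion M ↔ max (M / 2) 0 < E4.spatialNorm y := Iff.rfl

section IsoChart

variable {M : ℝ} {y x : E4}

/-- On the isotropic chart `ρ > 0`. [folklore] -/
theorem spatialNorm_pos_of_mem_iso (hy : y ∈ isotropicRegion M) : 0 < E4.spatialNorm y :=
  (le_max_right _ _).trans_lt hy

/-- On the isotropic chart `y⃗ ≠ 0`. [folklore] -/
theorem spatial_ne_zero_of_mem_iso (hy : y ∈ isotropicRegion M) : E4.spatial y ≠ 0 := by
  have h := spatialNorm_pos_of_mem_iso hy
  rw [E4.spatialNorm, norm_pos_iff] at h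
  exact h

/-- On the isotropic chart `ρ > M/2`. [folklore] -/
theorem half_lt_spatialNorm_of_mem_iso (hy : y ∈ isotropicRegion M) : M / 2 < E4.spatialNorm y :=
  (le_max_left _ _).trans_lt hy

/-- On the isotropic chart `φ = 1 − M/2ρ > 0`. [cite: BaumgarteShapiro2021, Exercise 1.7] -/
theorem isoPhi_pos_of_mem_iso (hy : y ∈ isotropicRegion M) : 0 < isoPhi M y := by
  have hρ := spatialNorm_pos_of_mem_iso hy
  have h := half_lt_spatialNorm_of_mem_iso hy
  rw [isoPhi, sub_pos, div_lt_one (by positivity)]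
  linarith

/-- On the isotropic chart, for `M ≥ 0`, `ψ = 1 + M/2ρ > 0`. [cite: BaumgarteShapiro2021, Exercise 1.5] -/
theorem isoPsi_pos_of_mem_iso (hM : 0 ≤ M) (hy : y ∈ isotropicRegion M) : 0 < isoPsi M y := by
  have hρ := spatialNorm_pos_of_mem_iso hy
  rw [isoPsi]
  positivity

/-- `toStaticFun M` maps the isotropic chart into the static chart `Kerr.exterior M 0` (`M ≥ 0`):
`r = ψ²ρ > 0` and `r − 2M = ρφ² > 0`. [cite: BaumgarteShapiro2021, Exercise 1.5 (1.44), Exercise 1.7] -/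
theorem toStaticFun_mem (hM : 0 ≤ M) (hy : y ∈ isotropicRegion M) :
    toStaticFun M y ∈ Kerr.exterior M 0 := by
  have hρ := spatialNorm_pos_of_mem_iso hy
  have hφ := isoPhi_pos_of_mem_iso hy
  have hψ := isoPsi_pos_of_mem_iso hM hy
  rw [Kerr.mem_exterior, Kerr.radius_zero_left, Kerr.rPlus_zero_right hM]
  refine max_lt ?_ ?_
  · have h := spatialNorm_toStaticFun_sub M hρ.ne'
    have h2 : 0 < E4.spatialNorm y * isoPhi M y ^ 2 := by positivity
    linarith
  · rw [spatialNorm_toStaticFun]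
    positivity

/-- `ofStaticFun M` maps the static chart into the isotropic chart (`M ≥ 0`): `ρ(r) > M/2 ≥ 0`.
[cite: BaumgarteShapiro2021, Exercise 1.5 (b)] -/
theorem ofStaticFun_mem (hM : 0 ≤ M) (hx : x ∈ Kerr.exterior M 0) :
    ofStaticFun M x ∈ isotropicRegion M := by
  have hr := spatialNorm_pos_of_mem hx
  have h2 := two_mul_lt_spatialNorm_of_mem hx
  rw [mem_isotropicRegion, spatialNorm_ofStaticFun M hr (isoRadius_pos hM h2).le]
  exact max_lt (half_lt_isoRadius h2) (isoRadius_pos hM h2)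

/-- `ofStaticFun ∘ toStaticFun = id` on the isotropic chart (`M ≥ 0`). [cite: BaumgarteShapiro2021, Exercise 1.5] -/
theorem ofStaticFun_toStaticFun (hM : 0 ≤ M) (hy : y ∈ isotropicRegion M) :
    ofStaticFun M (toStaticFun M y) = y := by
  have hρ := spatialNorm_pos_of_mem_iso hy
  have hφ := isoPhi_pos_of_mem_iso hy
  have hψ := isoPsi_pos_of_mem_iso hM hy
  have hrad : isoRadius M (E4.spatialNorm (toStaticFun M y)) = E4.spatialNorm y := by
    rw [spatialNorm_toStaticFun]
    exact isoRadius_areal hρ hψ.le hφ.le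
  refine E4_eq_of_apply_zero_of_spatial (by simp) ?_
  rw [spatial_ofStaticFun, hrad, spatialNorm_toStaticFun, spatial_toStaticFun, smul_smul]
  have h1 : E4.spatialNorm y / (isoPsi M y ^ 2 * E4.spatialNorm y) * isoPsi M y ^ 2 = 1 := by
    field_simp
  rw [h1, one_smul]

/-- `toStaticFun ∘ ofStaticFun = id` on the static chart (`M ≥ 0`). [cite: BaumgarteShapiro2021, Exercise 1.5] -/
theorem toStaticFun_ofStaticFun (hM : 0 ≤ M) (hx : x ∈ Kerr.exterior M 0) :
    toStaticFun M (ofStaticFun M x) = x := by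
  have hr := spatialNorm_pos_of_mem hx
  have h2 := two_mul_lt_spatialNorm_of_mem hx
  have hρ := isoRadius_pos hM h2
  have hnorm := spatialNorm_ofStaticFun M hr hρ.le
  have hψ : isoPsi M (ofStaticFun M x) ^ 2 * isoRadius M (E4.spatialNorm x) = E4.spatialNorm x := by
    rw [isoPsi, hnorm]
    exact areal_isoRadius hM h2
  refine E4_eq_of_apply_zero_of_spatial (by simp) ?_
  rw [spatial_toStaticFun, spatial_ofStaticFun, smul_smul]
  have h1 : isoPsi M (ofStaticFun M x) ^ 2 * (isoRadius M (E4.spatialNorm x) / E4.spatialNorm x) = 1 := by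
    rw [← mul_div_assoc, hψ, div_self hr.ne']
  rw [h1, one_smul]

/-- **The change of radius as a diffeomorphism** of the isotropic chart `{ρ > max(M/2, 0)}` onto the
static chart `Kerr.exterior M 0 = {r > max(2M, 0)}` (`M ≥ 0`): `(t, y⃗) ↦ (t, (1 + M/2ρ)² y⃗)`
(Baumgarte–Shapiro 2021, Exercise 1.5: `R = r(1 + M/2r)²`). [cite: BaumgarteShapiro2021, Exercise 1.5 (1.44)] -/
def ofIsotropic (hM : 0 ≤ M) :
    Diffeomorph 𝓘(ℝ, E4) 𝓘(ℝ, E4) (isotropicRegion M) (Kerr.exterior M 0) ∞ where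
  toFun y := ⟨toStaticFun M y, toStaticFun_mem hM y.2⟩
  invFun x := ⟨ofStaticFun M x, ofStaticFun_mem hM x.2⟩
  left_inv y := Subtype.ext (ofStaticFun_toStaticFun hM y.2)
  right_inv x := Subtype.ext (toStaticFun_ofStaticFun hM x.2)
  contMDiff_toFun := by
    refine (ContMDiff.subtypeVal_comp_iff _ _).1 fun y ↦ ?_
    exact (OpensChart.contMDiffAt_iff y _ (toStaticFun M) (fun _ ↦ rfl)).2
      (contDiffAt_toStaticFun (spatial_ne_zero_of_mem_iso y.2))
  contMDiff_invFun := by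
    refine (ContMDiff.subtypeVal_comp_iff _ _).1 fun x ↦ ?_
    exact (OpensChart.contMDiffAt_iff x _ (ofStaticFun M) (fun _ ↦ rfl)).2
      (contDiffAt_ofStaticFun (spatial_ne_zero_of_mem x.2) (two_mul_lt_spatialNorm_of_mem x.2))

/-- `ofIsotropic hM y = toStaticFun M y` as points of `E4`. [cite: BaumgarteShapiro2021, Exercise 1.5 (1.44)] -/
@[simp]
theorem coe_ofIsotropic (hM : 0 ≤ M) (y : isotropicRegion M) :
    (ofIsotropic hM y : E4) = toStaticFun M y := rfl

/-- `(ofIsotropic hM).symm x = ofStaticFun M x` as points of `E4`. [cite: BaumgarteShapiro2021, Exercise 1.5 (b)] -/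
@[simp]
theorem coe_ofIsotropic_symm (hM : 0 ≤ M) (x : Kerr.exterior M 0) :
    ((ofIsotropic hM).symm x : E4) = ofStaticFun M x := rfl

/-- **The differential of the change of radius is the Jacobian `J_y`.** [cite: BaumgarteShapiro2021, Exercise 1.5 (1.44)] -/
theorem mfderiv_ofIsotropic (hM : 0 ≤ M) (y : isotropicRegion M) :
    mfderiv 𝓘(ℝ, E4) 𝓘(ℝ, E4) (ofIsotropic hM) y = isoJacobian M y := by
  have hd : MDifferentiableAt 𝓘(ℝ, E4) 𝓘(ℝ, E4) (ofIsotropic hM) y :=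
    (ofIsotropic hM).contMDiff.mdifferentiableAt (by simp)
  have hF := hasFDerivAt_toStaticFun (M := M) (spatial_ne_zero_of_mem_iso y.2)
  have h1 : HasMFDerivAt 𝓘(ℝ, E4) 𝓘(ℝ, E4) (Subtype.val ∘ ofIsotropic hM) y
      ((ContinuousLinearMap.id ℝ E4).comp (mfderiv 𝓘(ℝ, E4) 𝓘(ℝ, E4) (ofIsotropic hM) y)) :=
    (Literature.Geometry.Manifold.OpenSubmanifold.hasMFDerivAt_subtype_val _).comp y
      hd.hasMFDerivAt
  have h2 : mfderiv 𝓘(ℝ, E4) 𝓘(ℝ, E4) (Subtype.val ∘ ofIsotropic hM) y = isoJacobian M y := by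
    have h := OpensChart.mfderiv_eq y (Subtype.val ∘ ofIsotropic hM) (toStaticFun M) (fun _ ↦ rfl)
      hF.differentiableAt
    rw [hF.fderiv] at h
    exact h
  rw [h1.mfderiv, ContinuousLinearMap.id_comp] at h2
  exact h2

/-- `∂_t ↦ ∂_t` under the change of radius. [cite: BaumgarteShapiro2021, Exercise 2.19 (2.109)] -/
theorem mfderiv_ofIsotropic_basisVector_zero (hM : 0 ≤ M) (y : isotropicRegion M) :
    mfderiv 𝓘(ℝ, E4) 𝓘(ℝ, E4) (ofIsotropic hM) y (E4.basisVector 0) = E4.basisVector 0 := by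
  rw [mfderiv_ofIsotropic]
  exact isoJacobian_basisVector_zero M y

/-- The differential of the change of radius is injective. [cite: BaumgarteShapiro2021, Exercise 1.5 (1.44)] -/
theorem mfderiv_ofIsotropic_injective (hM : 0 ≤ M) (y : isotropicRegion M) :
    Function.Injective (mfderiv 𝓘(ℝ, E4) 𝓘(ℝ, E4) (ofIsotropic hM) y) := by
  rw [mfderiv_ofIsotropic]
  exact isoJacobian_injective M (spatialNorm_pos_of_mem_iso y.2).ne'
    (isoPsi_pos_of_mem_iso hM y.2).ne' (isoPhi_pos_of_mem_iso y.2).ne'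

/-- **`(ofIsotropic)^* g_static = g_iso`**: the pull-back of the static form along the change of
radius is the isotropic form at every point of the isotropic chart (`M ≥ 0`).
[cite: BaumgarteShapiro2021, Exercise 1.5 (1.44)–(1.45)] -/
theorem pullbackBilin_ofIsotropic (hM : 0 ≤ M) (y : isotropicRegion M) :
    pullbackBilin (I := 𝓘(ℝ, E4)) (I' := 𝓘(ℝ, E4)) (ofIsotropic hM)
        (fun x : Kerr.exterior M 0 ↦ staticBilin M (x : E4)) y = isotropicBilin M y := by
  ext v w
  rw [pullbackBilin_apply, mfderiv_ofIsotropic]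
  exact staticBilin_isoJacobian M (spatialNorm_pos_of_mem_iso y.2).ne'
    (isoPsi_pos_of_mem_iso hM y.2).ne' (isoPhi_pos_of_mem_iso y.2).ne' v w

/-- `ofIsotropic hM` is of class `C^{∞ + 1} = C^∞`. [folklore] -/
theorem contMDiff_ofIsotropic_add_one (hM : 0 ≤ M) :
    ContMDiff 𝓘(ℝ, E4) 𝓘(ℝ, E4) (∞ + 1) (ofIsotropic hM) := by
  have h : ((∞ : ℕ∞ω) + 1) = ∞ := rfl
  rw [h]
  exact (ofIsotropic hM).contMDiff

/-- **The Schwarzschild exterior in isotropic coordinates** as a `C^∞` Lorentzian metric on the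
chart domain `{ρ > max(M/2, 0)}` (`M ≥ 0`): the pull-back of `staticMetric M` along the change of
radius; its value at `y` is the isotropic form `isotropicBilin M y` (`isotropicMetric_val`).
Baumgarte–Shapiro 2021, (1.45) = (2.109); O'Neill 1983, Ch. 3, pp. 90–91. [cite: BaumgarteShapiro2021, Exercise 1.5 (1.45); Exercise 2.19 (2.109)] -/
def isotropicMetric [Kerr.Facts] (hM : 0 ≤ M) : LorentzianMetric 𝓘(ℝ, E4) ∞ (isotropicRegion M) :=
  (staticMetric M).comap PseudoRiemannianMetric.contMDiff_pullbackBilin_holds (ofIsotropic hM)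
    (contMDiff_ofIsotropic_add_one hM) (mfderiv_ofIsotropic_injective hM) rfl

/-- **The value of the isotropic metric is the isotropic form** `−(φ/ψ)² dt² + ψ⁴ dy⃗²`.
[cite: BaumgarteShapiro2021, Exercise 1.5 (1.45)] -/
@[simp]
theorem isotropicMetric_val [Kerr.Facts] (hM : 0 ≤ M) (y : isotropicRegion M) :
    (isotropicMetric hM).val y = isotropicBilin M y := by
  ext v w
  have h1 : (isotropicMetric hM).val y v w =
      (staticMetric M).val (ofIsotropic hM y) (mfderiv 𝓘(ℝ, E4) 𝓘(ℝ, E4) (ofIsotropic hM) y v)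
        (mfderiv 𝓘(ℝ, E4) 𝓘(ℝ, E4) (ofIsotropic hM) y w) := rfl
  have h2 := staticMetric_val (M := M) (ofIsotropic hM y)
  rw [h1, h2, mfderiv_ofIsotropic]
  exact staticBilin_isoJacobian M (spatialNorm_pos_of_mem_iso y.2).ne'
    (isoPsi_pos_of_mem_iso hM y.2).ne' (isoPhi_pos_of_mem_iso y.2).ne' v w

/-- **The change of radius is an isometry of the isotropic Schwarzschild exterior onto the static
Schwarzschild exterior.** [cite: BaumgarteShapiro2021, Exercise 1.5 (1.44)–(1.45)] -/
theorem isIsometry_ofIsotropic [Kerr.Facts] (hM : 0 ≤ M) :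
    PseudoRiemannianMetric.IsIsometry (isotropicMetric hM).toPseudoRiemannianMetric
      (staticMetric M).toPseudoRiemannianMetric (ofIsotropic hM) :=
  fun _ ↦ rfl

/-- **Isotropic chart → Kerr–Schild chart**: the change of radius followed by the
Eddington–Finkelstein change of time is an isometry of the isotropic Schwarzschild exterior onto the
prelude's Kerr–Schild Schwarzschild exterior `(Kerr.exterior M 0, Kerr.smoothMetric M 0 r₊)` — the
shape demanded by `StationaryAFBlackHole.IsIsometricToSchwarzschildExterior`.
[cite: BaumgarteShapiro2021, Exercise 1.5; GriffithsPodolsky2009, §8.2] -/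
theorem isIsometry_ofIsotropic_trans_toKerrSchild [Kerr.Facts] (hM : 0 ≤ M) :
    PseudoRiemannianMetric.IsIsometry (isotropicMetric hM).toPseudoRiemannianMetric
      (Kerr.smoothMetric M 0 (Kerr.rPlus M 0)).toPseudoRiemannianMetric
      ((ofIsotropic hM).trans (toKerrSchild M)) :=
  isIsometry_trans_toKerrSchild (isIsometry_ofIsotropic hM)

/-- As for the static chart: an isometry `Ψ` of a region `(N, g_N)` onto the isotropic chart composed
with `ofIsotropic` and `toKerrSchild` is an isometry onto the Kerr–Schild Schwarzschild exterior.
[cite: BaumgarteShapiro2021, Exercise 1.5; GriffithsPodolsky2009, §8.2] -/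
theorem isIsometry_trans_ofIsotropic_trans_toKerrSchild [Kerr.Facts] (hM : 0 ≤ M) {EN HN : Type*}
    [NormedAddCommGroup EN] [NormedSpace ℝ EN] [TopologicalSpace HN] {IN : ModelWithCorners ℝ EN HN}
    {N : Type*} [TopologicalSpace N] [ChartedSpace HN N] [IsManifold IN ∞ N]
    {gN : PseudoRiemannianMetric IN ∞ EN (TangentSpace IN : N → Type _)}
    {Ψ : Diffeomorph IN 𝓘(ℝ, E4) N (isotropicRegion M) ∞}
    (hΨ : PseudoRiemannianMetric.IsIsometry gN (isotropicMetric hM).toPseudoRiemannianMetric Ψ) :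
    PseudoRiemannianMetric.IsIsometry gN
      (Kerr.smoothMetric M 0 (Kerr.rPlus M 0)).toPseudoRiemannianMetric
      (Ψ.trans ((ofIsotropic hM).trans (toKerrSchild M))) :=
  hΨ.trans (by simp) (isIsometry_ofIsotropic_trans_toKerrSchild hM)

end IsoChart

end Schwarzschild

end Literature.Geometry.Lorentzian
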